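import Literature.MathematicalPhysics.QuantumFieldTheory.WilsonFinTorusTwistedPartition
import Summits.QuantumFields.YangMills.Cruxes.IR.Lines.flux_purity_split
import HarnessLib

/-!
# ANOMALY SHEET g2 (ym-ir-idea-29, lens «anomaly»): the femto falsifier of `AnomalySheet.TwistSupermodular` and the
RE-TYPED statement — NOT filed as an item, NOT claimed; typed so that the crux idea `orthogonal-twist-supermodularity`
(rev 3) names elaborating statements.  HONEST LABEL: nothing here bears on the Clay problem; `IRcof`/`IR` stay 0∕1.

g0 typed `TwistSupermodular` for EVERY compact `G`, EVERY box `L³ × t`, EVERY `β ≥ 0`.  The located cheapest falsifier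
(critic ym-ir-crit-3 g5: the femto regime) KILLS that typing at print level: for `SU(2)` in the femto universe the lowest
two-unit electric-flux energy is SUPER-additive, `E(1,1,0) − E₀ > 2 (E(1,0,0) − E₀)` (Koller–van Baal 1988, Nucl. Phys.
B302, Table 7: `R₂ = 2.08 … 2.18 > 2` for `g(L) ∈ [1.3, 2.6]`, bounds resolving the sign; van Baal 2001 review p. 9:
`R_n ≈ n` «confirmed by Monte Carlo»), whence by the transfer matrix `Z(k)/Z = Σ_e (−1)^{k·e} Z_e/Z` the large-`t` sign of
`Z(c@0,c'@1)·Z − Z(c@0)·Z(c'@1)` is `sign (2ΔE₁ − ΔE₂) < 0` in small boxes at weak coupling.  The USED instance survives: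
cold CONFINED boxes (`L ≥ L₀(β)`, `t ∈ {⌊L/4⌋, 2⌊L/4⌋}`), where `Z_e/Z ≈ e^{−σ|e|Lt}` and `√2 < 2` give the sign `> 0`
(measured: TABLE-E2-Q3 j313871 rows C1 `+13.1σ`, C3 `+6.1σ`; strong coupling LO: critic's B2 identity, every `G`).

* `TwistSupermodularAllBoxes` — verbatim g0 `TwistSupermodular` (kept as the settled NEGATIVE edge; expected FALSE).
* `FemtoSubmodular` — its negation: the pre-registered prediction of the g2 second-instance Monte Carlo (E29-FEMTO).
* `TwistFKGColdBoxes` — the retreat: the two lattice-condition (FKG) instances actually consumed, two-plane AND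
  three-plane (g0's «`TwistSupermodular` twice» silently used the `{0,1}`-vs-`{2}` instance it never stated), for
  simply-connected compact simple `G`, in the cold 4:1 boxes beyond a β-dependent size `L₀(β)`.
* `ConfinedSinglePlaneTwistSC` — verbatim g0 (one-plane `F`).
* `SinglePlaneSufficesColdBoxes` — the composition BY NAME: `TwistFKGColdBoxes → ConfinedSinglePlaneTwistSC → F`
  (`F = FluxPuritySplit.ConfinedTemporalTwistSC`); bookkeeping: lower side `r(z₀z₁z₂) ≥ r(z₀,z₁) r(z₂) ≥ r(z₀) r(z₁) r(z₂)
  ≥ (1 − ε)³`, upper side `r ≤ 1` by flux-sector positivity (reflection positivity, tree `ElectricFluxPositivity`),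
  at `L ≥ max (L₀ β) (L₁ β)`.
-/

namespace Summit.QuantumFields.YangMills.Cruxes.IRcof.AnomalySheetG2

open MeasureTheory Literature.MathematicalPhysics.QuantumFieldTheory
open Summit.QuantumFields.YangMills.Cruxes.IR.FluxPuritySplit (twistedColdZ ConfinedTemporalTwistSC)

/-- The cold-box twisted partition function of the `IR` crux lines IS the Literature one (definitional). -/
theorem twistedColdZ_eq {G : Type} [Group G] [TopologicalSpace G] [IsTopologicalGroup G] [CompactSpace G]
    [MeasurableSpace G] [BorelSpace G] {n : ℕ} (ρ : G →* Matrix (Fin n) (Fin n) ℂ) (β : ℝ) (z : Fin 4 → G)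
    (L t : ℕ) : twistedColdZ ρ β z L t = wilsonFinTorusTwistedPartition ρ β z L L L t := rfl

/-- g0's `TwistSupermodular`, VERBATIM (every compact `G`, every box, every `β ≥ 0`).  KILLED AS TYPED at print level
(femto regime of `SU(2)`: Koller–van Baal 1988 Table 7, `E(e₂⁺) − E₀ > 2 (E(e₁⁺) − E₀)`); kept as the negative edge. -/
def TwistSupermodularAllBoxes : Prop :=
  ∀ (G : Type) [Group G] [TopologicalSpace G] [IsTopologicalGroup G] [CompactSpace G] [MeasurableSpace G]
    [BorelSpace G] (n : ℕ) (ρ : G →* Matrix (Fin n) (Fin n) ℂ), Continuous ρ →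
    ∀ β : ℝ, 0 ≤ β → ∀ c c' : G, c ∈ Subgroup.center G → c' ∈ Subgroup.center G →
    ∀ L t : ℕ,
      wilsonFinTorusTwistedPartition ρ β (Function.update (1 : Fin 4 → G) 0 c) L L L t *
          wilsonFinTorusTwistedPartition ρ β (Function.update (1 : Fin 4 → G) 1 c') L L L t ≤
        wilsonFinTorusTwistedPartition ρ β (Function.update (Function.update (1 : Fin 4 → G) 0 c) 1 c') L L L t *
          wilsonFinTorusTwistedPartition ρ β (1 : Fin 4 → G) L L L t

/-- **E29-FEMTO (pre-registered prediction, g2).**  Orthogonal temporal twists are strictly SUB-modular somewhere: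
print says `G = SU(2)`, fundamental Wilson action, `L ≲ 5 ξ(β)`, `t ≳ 2L` (`D₂ ≈ −0.01 … −0.03`, i.e.
`ln (Z(2 planes) Z / Z(1 plane)²) ≈ −0.05 … −0.12` from the 8-level transfer matrix with the Table-7 energies). -/
def FemtoSubmodular : Prop := ¬ TwistSupermodularAllBoxes

/-- **The retreat (the USED instance): FKG lattice condition of the temporally twisted partition function in the cold
4:1 boxes of a simply-connected compact simple `G`, beyond a `β`-dependent size.**  Two clauses: planes `{0}` vs `{1}`,
and planes `{0,1}` vs `{2}`.  Why it might fail: only if some cold-box regime beyond every `L₀(β)` keeps orthogonal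
electric fluxes repelling (`E(1,1,0) ≥ 2E(1,0,0)`), i.e. no string formation at that `β` — the femto repulsion
(`|c₁ × c₂|²` magnetic energy of simultaneous zero-mode excursions) dies once `L ≳ 5–6 ξ` (van Baal 2001, p. 9–10). -/
def TwistFKGColdBoxes : Prop :=
  ∀ (G : Type) [Group G] [TopologicalSpace G] [IsTopologicalGroup G] [CompactSpace G],
    IsCompactSimpleLieGroup G → SimplyConnectedSpace G →
    letI : MeasurableSpace G := borel G
    haveI : BorelSpace G := ⟨rfl⟩
    ∀ r : LatticeRep G, ∀ β : ℝ, 0 ≤ β → ∃ L₀ : ℕ, ∀ L : ℕ, L₀ ≤ L →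
      ∀ c c' c'' : G, c ∈ Subgroup.center G → c' ∈ Subgroup.center G → c'' ∈ Subgroup.center G →
      ∀ t : ℕ, (t = L / 4 ∨ t = 2 * (L / 4)) →
        twistedColdZ r.ρ β (Function.update (1 : Fin 4 → G) 0 c) L t *
            twistedColdZ r.ρ β (Function.update (1 : Fin 4 → G) 1 c') L t ≤
          twistedColdZ r.ρ β (Function.update (Function.update (1 : Fin 4 → G) 0 c) 1 c') L t *
            twistedColdZ r.ρ β (1 : Fin 4 → G) L t ∧
        twistedColdZ r.ρ β (Function.update (Function.update (1 : Fin 4 → G) 0 c) 1 c') L t *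
            twistedColdZ r.ρ β (Function.update (1 : Fin 4 → G) 2 c'') L t ≤
          twistedColdZ r.ρ β (Function.update (Function.update (Function.update (1 : Fin 4 → G) 0 c) 1 c') 2 c'') L t *
            twistedColdZ r.ρ β (1 : Fin 4 → G) L t

/-- F restricted to ONE temporal plane class (verbatim g0): every SINGLE-plane central twist `update 1 μ c` is
`ε`-invisible in the cold 4:1 boxes. -/
def ConfinedSinglePlaneTwistSC : Prop :=
  ∀ (G : Type) [Group G] [TopologicalSpace G] [IsTopologicalGroup G] [CompactSpace G],
    IsCompactSimpleLieGroup G → SimplyConnectedSpace G →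
    letI : MeasurableSpace G := borel G
    haveI : BorelSpace G := ⟨rfl⟩
    ∀ r : LatticeRep G, ∀ ε : ℝ, 0 < ε → ∃ β₁ : ℝ, ∀ β : ℝ, β₁ ≤ β → ∃ L₁ : ℕ, ∀ L : ℕ, L₁ ≤ L →
      ∀ (μ : Fin 4) (c : G), c ∈ Subgroup.center G → ∀ t : ℕ, (t = L / 4 ∨ t = 2 * (L / 4)) →
        |twistedColdZ r.ρ β (Function.update 1 μ c) L t - wilsonFinTorusPartition r.ρ β L L L t| ≤
          ε * wilsonFinTorusPartition r.ρ β L L L t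

/-- R2 re-typed, BY NAME (statement only): cold-box FKG plus one-plane confinement of temporal twist give idea-10's `F`.
Bookkeeping at `L ≥ max (L₀ β) (L₁ β)`: `(1−ε')³ ≤ r(c)r(c')r(c'') ≤ r(c,c')r(c'') ≤ r(c,c',c'') ≤ 1`, the last step by
flux-sector positivity `Z^{(z)} = Σ_e χ_e(z) Z_e`, `Z_e ≥ 0` (reflection positivity), not by pointwise domination. -/
def SinglePlaneSufficesColdBoxes : Prop :=
  TwistFKGColdBoxes → ConfinedSinglePlaneTwistSC → ConfinedTemporalTwistSC

end Summit.QuantumFields.YangMills.Cruxes.IRcof.AnomalySheetG2
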